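import Mathlib.AlgebraicGeometry.EllipticCurve.VariableChange
import Mathlib.RingTheory.DedekindDomain.AdicValuation
import Mathlib.Topology.Algebra.Valued.ValuationTopology
import HarnessLib

/-!
# A `K`-rational change of variables with prescribed `v`-adic shapes of `b₂, b₄, b₆, Δ` from a
# `K_v`-rational one (Tate's normal forms made global; Silverman *ATAEC* IV.9.4, III.1)

`Proofs` file (theorems only, no definitions, no named facts), landed by the seat of bsd.S15
(`Literature.NumberTheory.EllipticCurves.conductorNorm_eq_artinConductorNat_of_isElliptic`) as
glue between the **discriminant side** of Ogg's formula for the wild Kodaira types at `p = 3`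
(`OggFormulaWildTypesKodairaProofs.exists_variableChange_b_of_kodairaSymbolAt_wild`, which produces
a change of variables over the completion `K_v` with `b₂ = π^{k₂}β₂`, `b₄ = π^{k₄}β₄`,
`b₆ = π^{k₆}·unit`, `Δ = π^{e}·unit`) and the **Galois side**
(`OggWildThreeLinearProofs`, `OggWildThreeQuadraticProofs`, which need a Weierstrass equation
over the number field `K` itself):

* `WeierstrassCurve.exists_valuation_sub_eq` — density of `K` in `K_v` in valuation form: for
  `r ∈ K_v` and `c ≠ 0` there is `r' ∈ K` with `v(r' - r) = v(c)`;
* `WeierstrassCurve.exists_variableChange_valuation_of_adicCompletion` — from such a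
  `K_v`-rational change of variables, a change of variables **over `K`** with `ord_v(b₂) ≥ k₂`,
  `ord_v(b₄) ≥ k₄`, `ord_v(b₆) = k₆`, `ord_v(Δ) = e` on the new equation: `b₂, b₄, b₆, Δ` only
  involve `u` and `r` (`u⁻²(b₂ + 12r)`, `u⁻⁴(b₄ + rb₂ + 6r²)`, `u⁻⁶(b₆ + 2rb₄ + r²b₂ + 4r³)`,
  `u⁻¹²Δ`), so one may take `u' = π^{-ord_v u} ∈ K` and `r' ∈ K` with `v(r' - r)` small; the
  numerators change by multiples of `r' - r`, which the ultrametric inequality absorbs.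

General over a Dedekind domain `A` with fraction field `K` and a place `v`.
No definitions, no named facts.  All axioms `propext`, `Classical.choice`, `Quot.sound`.

## References

* J. H. Silverman, *Advanced Topics in the Arithmetic of Elliptic Curves*, GTM 151 (1994), IV.9.4
  (Tate's algorithm over `𝒪_v`) and proof of Thm. IV.11.1 for `p = 3` (PDF pp. 366–371);
  *AEC* III.1 (change of variables formulae, Table 3.1). [SilvermanATAEC1994] [SilvermanAEC2009]
-/

noncomputable section

open scoped Classical
open IsDedekindDomain WithZero

namespace WeierstrassCurve

variable {A : Type*} [CommRing A] [IsDedekindDomain A] {K : Type*} [Field K] [Algebra A K]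
  [IsFractionRing A K] (v : HeightOneSpectrum A) (X : WeierstrassCurve K)

/-- **Density of `K` in `K_v`, valuation form**: for `r ∈ K_v` and a non-zero `c ∈ K_v` there is
`r' ∈ K` with `v(r' - r) = v(c)` (`Valued.locally_const` at `c`, translated by `r`, and
`HeightOneSpectrum.denseRange_algebraMap`). [folklore] -/
theorem exists_valuation_sub_eq (r c : v.adicCompletion K) (hc : Valued.v c ≠ 0) :
    ∃ r' : K, Valued.v (algebraMap K (v.adicCompletion K) r' - r) = Valued.v c := by
  have hnhds : {y : v.adicCompletion K | Valued.v (y - r) = Valued.v c} ∈ nhds (r + c) := by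
    have h1 : {y : v.adicCompletion K | Valued.v y = Valued.v c} ∈ nhds c := Valued.locally_const hc
    have h2 : ContinuousAt (fun y : v.adicCompletion K ↦ y - r) (r + c) :=
      (continuous_sub_right r).continuousAt
    have h3 := h2.preimage_mem_nhds (by rwa [add_sub_cancel_left])
    exact h3
  obtain ⟨y, ⟨r', rfl⟩, hy⟩ := (v.denseRange_algebraMap (K := K)).inter_nhds_nonempty hnhds
  exact ⟨r', hy⟩

/-- **A `K`-rational model with the `v`-adic shapes of a `K_v`-rational one.**  Let `C` be a change
of variables over `K_v` such that `C • E_{K_v}` has `b₂ = π^{k₂}β₂`, `b₄ = π^{k₄}β₄`,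
`b₆ = π^{k₆}β₆`, `Δ = π^{e}δ` with `βᵢ ∈ 𝒪_v`, `β₆, δ ∈ 𝒪_v^×` (`π ∈ K`, `ord_v(π) = 1`).  Then
some change of variables `C'` **over `K`** gives `ord_v(b₂(C' • E)) ≥ k₂`, `ord_v(b₄) ≥ k₄`,
`ord_v(b₆) = k₆`, `ord_v(Δ) = e`.  Indeed only `u` and `r` enter `b₂, b₄, b₆, Δ`
(`b₂' = u⁻²(b₂ + 12r)`, `b₄' = u⁻⁴(b₄ + rb₂ + 6r²)`, `b₆' = u⁻⁶(b₆ + 2rb₄ + r²b₂ + 4r³)`,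
`Δ' = u⁻¹²Δ`); take `u' = π^{-ord_v(u)} ∈ K` and `r' ∈ K` close to `r` (`exists_valuation_sub_eq`):
the perturbations of the three numerators are multiples of `r' - r` and do not change the
(in)equalities (ultrametric inequality).  This passes from the normal forms of Tate's algorithm
over `𝒪_v` (Silverman *ATAEC* IV.9.4) to a global Weierstrass equation.
[cite: SilvermanATAEC1994, IV.9.4 (Tate's algorithm) with III.1 (change of variables formulae)] -/
theorem exists_variableChange_valuation_of_adicCompletion
    (C : VariableChange (v.adicCompletion K)) {π : K}
    (hπ : v.valuation K π = exp (-1 : ℤ)) {k₂ k₄ k₆ e : ℕ}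
    {β₂ β₄ β₆ δ : v.adicCompletionIntegers K} (hβ₆ : IsUnit β₆) (hδ : IsUnit δ)
    (hb₂ : (C • X.baseChange (v.adicCompletion K)).b₂ = (π : v.adicCompletion K) ^ k₂ * β₂)
    (hb₄ : (C • X.baseChange (v.adicCompletion K)).b₄ = (π : v.adicCompletion K) ^ k₄ * β₄)
    (hb₆ : (C • X.baseChange (v.adicCompletion K)).b₆ = (π : v.adicCompletion K) ^ k₆ * β₆)
    (hΔ : (C • X.baseChange (v.adicCompletion K)).Δ = (π : v.adicCompletion K) ^ e * δ) :
    ∃ C' : VariableChange K,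
      v.valuation K (C' • X).b₂ ≤ exp (-(k₂ : ℤ)) ∧ v.valuation K (C' • X).b₄ ≤ exp (-(k₄ : ℤ)) ∧
      v.valuation K (C' • X).b₆ = exp (-(k₆ : ℤ)) ∧ v.valuation K (C' • X).Δ = exp (-(e : ℤ)) := by
  -- notation and basic valuations
  set ι := algebraMap K (v.adicCompletion K) with hι
  set w : Valuation (v.adicCompletion K) ℤᵐ⁰ := Valued.v with hw
  have hcoe : ∀ x : K, w (ι x) = v.valuation K x :=
    fun x ↦ HeightOneSpectrum.valuedAdicCompletion_eq_valuation' v x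
  have hπι : (π : v.adicCompletion K) = ι π := rfl
  have hπv : w (ι π) = exp (-1 : ℤ) := by rw [hcoe, hπ]
  have hπ0 : π ≠ 0 := by
    rintro rfl
    rw [map_zero] at hπ
    exact exp_ne_zero hπ.symm
  have hπv0 : ι π ≠ 0 := (map_ne_zero ι).mpr hπ0
  have hint : ∀ β : v.adicCompletionIntegers K, w (β : v.adicCompletion K) ≤ 1 := fun β ↦ β.2
  have hunit : ∀ {β : v.adicCompletionIntegers K}, IsUnit β → w (β : v.adicCompletion K) = 1 := by
    intro β hβ
    obtain ⟨γ, hγ⟩ := hβ.exists_right_inv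
    have h1 : w (β : v.adicCompletion K) * w (γ : v.adicCompletion K) = 1 := by
      rw [← map_mul, ← Subring.coe_mul, hγ]; simp
    refine le_antisymm (hint β) ?_
    calc (1 : ℤᵐ⁰) = w (β : v.adicCompletion K) * w (γ : v.adicCompletion K) := h1.symm
      _ ≤ w (β : v.adicCompletion K) * 1 := mul_le_mul_right (hint γ) _
      _ = _ := mul_one _
  have hnat : ∀ n : ℕ, w (n : v.adicCompletion K) ≤ 1 := fun n ↦ by
    rw [← map_natCast ι n, hcoe, ← map_natCast (algebraMap A K) n]
    exact v.valuation_le_one _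
  have h12 : w (12 : v.adicCompletion K) ≤ 1 := by exact_mod_cast hnat 12
  have h6 : w (6 : v.adicCompletion K) ≤ 1 := by exact_mod_cast hnat 6
  have h4 : w (4 : v.adicCompletion K) ≤ 1 := by exact_mod_cast hnat 4
  have h2 : w (2 : v.adicCompletion K) ≤ 1 := by exact_mod_cast hnat 2
  -- `u` and its valuation `exp bu`
  set u : v.adicCompletion K := (C.u : v.adicCompletion K) with hu
  have hu0 : u ≠ 0 := C.u.ne_zero
  have hwu0 : w u ≠ 0 := (map_ne_zero w).mpr hu0
  set bu : ℤ := log (w u) with hbu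
  have hU : w u = exp bu := (exp_log hwu0).symm
  have hCu : (↑C.u⁻¹ : v.adicCompletion K) * u = 1 := by rw [hu, Units.inv_mul]
  -- the numerators on the `K_v`-model
  set r : v.adicCompletion K := C.r with hr
  set B₂ : v.adicCompletion K := ι X.b₂ + 12 * r with hB₂
  set B₄ : v.adicCompletion K := ι X.b₄ + r * ι X.b₂ + 6 * r ^ 2 with hB₄
  set B₆ : v.adicCompletion K := ι X.b₆ + 2 * r * ι X.b₄ + r ^ 2 * ι X.b₂ + 4 * r ^ 3 with hB₆
  have hXb₂ : (X.baseChange (v.adicCompletion K)).b₂ = ι X.b₂ := by simp [baseChange, map_b₂, hι]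
  have hXb₄ : (X.baseChange (v.adicCompletion K)).b₄ = ι X.b₄ := by simp [baseChange, map_b₄, hι]
  have hXb₆ : (X.baseChange (v.adicCompletion K)).b₆ = ι X.b₆ := by simp [baseChange, map_b₆, hι]
  have hXΔ : (X.baseChange (v.adicCompletion K)).Δ = ι X.Δ := by simp [baseChange, map_Δ, hι]
  have cancel : ∀ (k : ℕ) (x : v.adicCompletion K), u ^ k * ((↑C.u⁻¹ : v.adicCompletion K) ^ k * x) = x :=
    fun k x ↦ by rw [← mul_assoc, ← mul_pow, mul_comm u, hCu, one_pow, one_mul]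
  have eB₂ : B₂ = u ^ 2 * (ι π ^ k₂ * β₂) := by
    have h := hb₂
    rw [variableChange_b₂, hXb₂] at h
    rw [← hπι, ← h, cancel]
  have eB₄ : B₄ = u ^ 4 * (ι π ^ k₄ * β₄) := by
    have h := hb₄
    rw [variableChange_b₄, hXb₂, hXb₄] at h
    rw [← hπι, ← h, cancel]
  have eB₆ : B₆ = u ^ 6 * (ι π ^ k₆ * β₆) := by
    have h := hb₆
    rw [variableChange_b₆, hXb₂, hXb₄, hXb₆] at h
    rw [← hπι, ← h, cancel]
  have eΔ : ι X.Δ = u ^ 12 * (ι π ^ e * δ) := by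
    have h := hΔ
    rw [variableChange_Δ, hXΔ] at h
    rw [← hπι, ← h, cancel]
  have hπk : ∀ k : ℕ, w (ι π ^ k) = exp (-(k : ℤ)) := fun k ↦ by
    rw [map_pow, hπv, ← exp_nsmul]; simp
  have hexp : ∀ (k : ℕ) (b : ℤ), exp b ^ k = exp ((k : ℤ) * b) := fun k b ↦ by
    rw [← exp_nsmul]; simp
  have wB₂ : w B₂ ≤ exp (2 * bu - k₂) := by
    rw [eB₂, map_mul, map_mul, map_pow, hU, hπk, hexp]
    calc exp ((2 : ℕ) * bu) * (exp (-(k₂ : ℤ)) * w (β₂ : v.adicCompletion K))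
        ≤ exp ((2 : ℕ) * bu) * (exp (-(k₂ : ℤ)) * 1) :=
          mul_le_mul_right (mul_le_mul_right (hint β₂) _) _
      _ = exp (2 * bu - k₂) := by rw [mul_one, ← exp_add]; congr 1
  have wB₄ : w B₄ ≤ exp (4 * bu - k₄) := by
    rw [eB₄, map_mul, map_mul, map_pow, hU, hπk, hexp]
    calc exp ((4 : ℕ) * bu) * (exp (-(k₄ : ℤ)) * w (β₄ : v.adicCompletion K))
        ≤ exp ((4 : ℕ) * bu) * (exp (-(k₄ : ℤ)) * 1) :=
          mul_le_mul_right (mul_le_mul_right (hint β₄) _) _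
      _ = exp (4 * bu - k₄) := by rw [mul_one, ← exp_add]; congr 1
  have wB₆ : w B₆ = exp (6 * bu - k₆) := by
    rw [eB₆, map_mul, map_mul, map_pow, hU, hπk, hunit hβ₆, mul_one, hexp, ← exp_add]
    congr 1
  have wΔ : w (ι X.Δ) = exp (12 * bu - e) := by
    rw [eΔ, map_mul, map_mul, map_pow, hU, hπk, hunit hδ, mul_one, hexp, ← exp_add]
    congr 1
  -- the approximation `r'` of `r`: `w(r' - r) = w(π^{N} u²)`, `N = k₂ + k₄ + k₆ + 1`
  set N : ℕ := k₂ + k₄ + k₆ + 1 with hN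
  obtain ⟨r', hr'⟩ := exists_valuation_sub_eq v r (ι π ^ N * u ^ 2)
    (by rw [map_ne_zero]; exact mul_ne_zero (pow_ne_zero _ hπv0) (pow_ne_zero _ hu0))
  set ρ : v.adicCompletion K := ι r' - r with hρ
  have wρ : w ρ = exp (2 * bu - N) := by
    change Valued.v (ι r' - r) = _ at hr'
    rw [hρ, hw, hr', map_mul, map_pow, map_pow]
    change w (ι π) ^ N * w u ^ 2 = _
    rw [hπv, hU, hexp, hexp, ← exp_add]; congr 1; push_cast; ring
  -- the new change of variables over `K`
  set u' : K := π ^ (-bu) with hu'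
  have hu'0 : u' ≠ 0 := zpow_ne_zero _ hπ0
  have wu' : w (ι u') = exp bu := by
    rw [hcoe, hu', map_zpow₀, hπ, ← exp_zsmul]; congr 1; simp
  have wu'k : ∀ k : ℕ, w (ι ((↑(Units.mk0 u' hu'0)⁻¹ : K) ^ k)) = exp (-((k : ℤ) * bu)) := fun k ↦ by
    rw [Units.val_inv_eq_inv_val, Units.val_mk0, map_pow, map_inv₀, map_pow, map_inv₀, wu',
      ← exp_neg, hexp]; congr 1; ring
  refine ⟨⟨Units.mk0 u' hu'0, r', 0, 0⟩, ?_, ?_, ?_, ?_⟩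
  · -- `b₂`
    rw [← hcoe, variableChange_b₂, map_mul, map_mul, wu'k]
    have key : ι (X.b₂ + 12 * r') = B₂ + 12 * ρ := by
      rw [map_add, map_mul, map_ofNat, hB₂, hρ]; ring
    rw [key]
    have h12ρ : w (12 * ρ) ≤ exp (2 * bu - k₂) := by
      rw [map_mul, wρ]
      calc w (12 : v.adicCompletion K) * exp (2 * bu - N) ≤ 1 * exp (2 * bu - N) :=
            mul_le_mul_left h12 _
        _ ≤ exp (2 * bu - k₂) := by rw [one_mul, exp_le_exp]; omega
    calc exp (-((2 : ℕ) * bu)) * w (B₂ + 12 * ρ) ≤ exp (-((2 : ℕ) * bu)) * exp (2 * bu - k₂) :=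
          mul_le_mul_right (w.map_add_le wB₂ h12ρ) _
      _ = exp (-(k₂ : ℤ)) := by rw [← exp_add]; congr 1; push_cast; ring
  · -- `b₄`
    rw [← hcoe, variableChange_b₄, map_mul, map_mul, wu'k]
    have key : ι (X.b₄ + r' * X.b₂ + 6 * r' ^ 2) = B₄ + ρ * (B₂ + 6 * ρ) := by
      rw [map_add, map_add, map_mul, map_mul, map_pow, map_ofNat, hB₄, hB₂, hρ]; ring
    rw [key]
    have hin : w (B₂ + 6 * ρ) ≤ exp (2 * bu) := by
      refine w.map_add_le (wB₂.trans ?_) ?_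
      · rw [exp_le_exp]; omega
      · rw [map_mul, wρ]
        calc w (6 : v.adicCompletion K) * exp (2 * bu - N) ≤ 1 * exp (2 * bu - N) :=
              mul_le_mul_left h6 _
          _ ≤ exp (2 * bu) := by rw [one_mul, exp_le_exp]; omega
    have hpert : w (ρ * (B₂ + 6 * ρ)) ≤ exp (4 * bu - k₄) := by
      rw [map_mul, wρ]
      calc exp (2 * bu - N) * w (B₂ + 6 * ρ) ≤ exp (2 * bu - N) * exp (2 * bu) :=
            mul_le_mul_right hin _
        _ ≤ exp (4 * bu - k₄) := by rw [← exp_add, exp_le_exp]; omega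
    calc exp (-((4 : ℕ) * bu)) * w (B₄ + ρ * (B₂ + 6 * ρ)) ≤
        exp (-((4 : ℕ) * bu)) * exp (4 * bu - k₄) := mul_le_mul_right (w.map_add_le wB₄ hpert) _
      _ = exp (-(k₄ : ℤ)) := by rw [← exp_add]; congr 1; push_cast; ring
  · -- `b₆`: the perturbation is strictly smaller
    rw [← hcoe, variableChange_b₆, map_mul, map_mul, wu'k]
    have key : ι (X.b₆ + 2 * r' * X.b₄ + r' ^ 2 * X.b₂ + 4 * r' ^ 3) =
        B₆ + ρ * (2 * B₄ + ρ * B₂ + 4 * ρ ^ 2) := by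
      rw [map_add, map_add, map_add, map_mul, map_mul, map_mul, map_mul, map_pow, map_pow,
        map_ofNat, map_ofNat, hB₆, hB₄, hB₂, hρ]; ring
    rw [key]
    have hin : w (2 * B₄ + ρ * B₂ + 4 * ρ ^ 2) ≤ exp (4 * bu) := by
      refine w.map_add_le (w.map_add_le ?_ ?_) ?_
      · rw [map_mul]
        calc w (2 : v.adicCompletion K) * w B₄ ≤ 1 * exp (4 * bu - k₄) := mul_le_mul' h2 wB₄
          _ ≤ exp (4 * bu) := by rw [one_mul, exp_le_exp]; omega
      · rw [map_mul, wρ]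
        calc exp (2 * bu - N) * w B₂ ≤ exp (2 * bu - N) * exp (2 * bu - k₂) :=
              mul_le_mul_right wB₂ _
          _ ≤ exp (4 * bu) := by rw [← exp_add, exp_le_exp]; omega
      · rw [map_mul, map_pow, wρ, hexp]
        calc w (4 : v.adicCompletion K) * exp ((2 : ℕ) * (2 * bu - N)) ≤
            1 * exp ((2 : ℕ) * (2 * bu - N)) := mul_le_mul_left h4 _
          _ ≤ exp (4 * bu) := by rw [one_mul, exp_le_exp]; push_cast; omega
    have hpert : w (ρ * (2 * B₄ + ρ * B₂ + 4 * ρ ^ 2)) < w B₆ := by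
      rw [map_mul, wρ, wB₆]
      calc exp (2 * bu - N) * w (2 * B₄ + ρ * B₂ + 4 * ρ ^ 2) ≤ exp (2 * bu - N) * exp (4 * bu) :=
            mul_le_mul_right hin _
        _ < exp (6 * bu - k₆) := by rw [← exp_add, exp_lt_exp]; omega
    rw [w.map_add_eq_of_lt_left hpert, wB₆, ← exp_add]
    congr 1; push_cast; ring
  · -- `Δ`
    rw [← hcoe, variableChange_Δ, map_mul, map_mul, wu'k, wΔ, ← exp_add]
    congr 1; push_cast; ring

end WeierstrassCurve

end
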